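import Summits.BirchSwinnertonDyer.BirchSwinnertonDyer.Theorems.SignedBaseChangeAnticyclotomicEisensteinDivisibilityNakayamaDualTwoVarDuality
import HarnessLib

/-!
# Nakayama's lemma for Pontryagin duals over `Λ₂ = ℤ_p⟦T₂⟧⟦T₁⟧`, II: the compactness argument and the
# registered stub `stub_nakayamaDualTwoVar` (crux `AnticyclotomicEisensteinDivisibility`,
# stmt-BirchSwinnertonDyer-20727, line `bdpline` v5 — file 2 of 2)

Helper file (THEOREMS ONLY — no definition, no named fact) proving the registered stub
`stub_nakayamaDualTwoVar` of `Cruxes/AnticyclotomicEisensteinDivisibility/Lines/bdpline.lean` (v5, sha16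
a2d82a1129796d3f) VERBATIM: **Nakayama's lemma for Pontryagin duals over `Λ₂ = ℤ_p⟦T₂⟧⟦T₁⟧`** — if a
`Λ₂`-module `X` is identified (`toDual`, bijective) with `Hom(S, ℚ/ℤ)` for an abelian group `S` carrying two
commuting locally nilpotent endomorphisms `ψ₁, ψ₂` (`IwasawaDual.IsLocNil₂`), with `T₁ = X` acting as
`ψ₁`, `T₂ = C X` as `ψ₂`, constants `C (C c)` through `ℤ_p → ℤ/p^k`, and the joint kernel
`S[p] ∩ ker ψ₁ ∩ ker ψ₂` (the dual of `X/𝔪X`, `𝔪 = (p, T₁, T₂)`) is finite, then `X` is finitely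
generated over `Λ₂`. The two-variable twin of the tree's `IwasawaDual.IsDualPair.module_finite`
(`IwasawaNakayamaProofs.lean`), transposed line by line (Lang, *Cyclotomic Fields I and II*, Ch. 5 §1
"(ii) If `𝔬` is compact, and `V/𝔪V` is finitely generated, then `V` is finitely generated"; Greenberg,
LNM 1716, §1 p. 60):

1. *Filtration* (inside `module_finite_of_dualPair₂`): `X⁽ⁿ⁾ = Ann{s | pⁿs = ψ₁ⁿs = ψ₂ⁿs = 0}`,
   `M_0 = X`, `M_{k+1} = pM_k + T₁M_k + T₂M_k`; `⋂ X⁽ⁿ⁾ = 0` (local nilpotence, injectivity of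
   `toDual`); `M_{3n} ⊆ X⁽ⁿ⁾` (a word of length `3n` in `p, T₁, T₂` contains one letter `n` times; only
   the action identities and `ψ₁ψ₂ = ψ₂ψ₁` are used); `X⁽¹⁾ ⊆ M_1` (duality,
   `exists_eq_nsmul_add_smul_add_smul_of_forall` of file I).
2. *Generators*: `X/X⁽¹⁾ ↪ Hom(S_1, ℚ/ℤ[p])` is finite when `S_1` is; lifts `x_r` span `N` with
   `N + M_1 = X`, hence `N + M_k = X` for all `k` (bootstrapping) and `N + X⁽ⁿ⁾ = X`.
3. *Compactness*: `Λ₂^d` is compact in the product topology (`PowerSeries.WithPiTopology` twice,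
   Tychonoff, `PadicInt.compactSpace`); the sets `A_n = {a | x − ∑ a_r x_r ∈ X⁽ⁿ⁾}` are non-empty,
   decreasing and clopen (congruent coefficient vectors act alike modulo `X⁽ⁿ⁾`:
   `exists_eq_C_mul_add_X_pow_mul_add`, `isOpen_setOf_coeff_cong₂` of file I); Cantor's intersection
   theorem gives `a ∈ ⋂ A_n`, and `x − ∑ a_r x_r ∈ ⋂ X⁽ⁿ⁾ = 0`.

The composition of the line applies the stub with `S = unrSelmer₂ …`, `X = XGr₂ …`, `toDual = id`,
`ψᵢ = conjSel₂ γᵢ − 1`. Nothing here bears on the other stubs of the line or on BSD.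

## References
* S. Lang, *Cyclotomic Fields I and II*, GTM 121 (1990), Ch. 5 §1 (Nakayama's lemma, p. 94).
* R. Greenberg, *Iwasawa theory for elliptic curves*, LNM 1716 (1999), §1 p. 60 (after Conj. 1.3).
* K. Rubin, Invent. Math. 103 (1991), §4 p. 36 (`Λ = ℤ_p[[𝒢]]`, two variables).
-/

-- D-0017: single-problem summit, the namespace repeats the problem name by design.
set_option linter.dupNamespace false
set_option autoImplicit false

open Literature.NumberTheory.EllipticCurves

noncomputable section

namespace Summit.BirchSwinnertonDyer.BirchSwinnertonDyer.Theorems.SignedBaseChangeAcDivNakayamaTwoVar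

open scoped PowerSeries.WithPiTopology

/-- **Nakayama's lemma for Pontryagin duals over `Λ₂ = ℤ_p⟦T₂⟧⟦T₁⟧`** (Lang, *Cyclotomic Fields*,
Ch. 5 §1 (ii), in the untopologised axiomatic setting of the tree's one-variable
`IwasawaDual.IsDualPair.module_finite`, two variables): for a `Λ₂`-module `X` with a group isomorphism
`toDual : X ≃ Hom(S, ℚ/ℤ)` under which `T₁ = X` acts as `ψ₁`, `T₂ = C X` as `ψ₂` and constants through
`ℤ_p → ℤ/p^k`, with `(p, ψ₁, ψ₂)` commuting and locally nilpotent on `S`: if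
`S_1 = {s | p s = 0, ψ₁ s = 0, ψ₂ s = 0}` is finite then `X` is finitely generated over `Λ₂`, by lifts of
the finitely many restrictions `toDual x|_{S_1}`. Proof: module docstring, steps 1–3.
[cite: Lang1990, Ch. 5 §1 (Nakayama's lemma)] [cite: GreenbergLNM1716, §1 p. 60 (after Conj. 1.3)] -/
theorem module_finite_of_dualPair₂ {p : ℕ} [Fact p.Prime] {S X : Type*} [AddCommGroup S]
    [AddCommGroup X] [Module (PowerSeries (PowerSeries ℤ_[p])) X] {ψ₁ ψ₂ : AddMonoid.End S}
    (toDual : X →+ (S →+ AddCircle (1 : ℚ))) (hbij : Function.Bijective toDual)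
    (hT₁ : ∀ (x : X) (s : S),
      toDual ((PowerSeries.X : PowerSeries (PowerSeries ℤ_[p])) • x) s = toDual x (ψ₁ s))
    (hT₂ : ∀ (x : X) (s : S),
      toDual ((PowerSeries.C (PowerSeries.X : PowerSeries ℤ_[p]) : PowerSeries (PowerSeries ℤ_[p])) • x) s =
        toDual x (ψ₂ s))
    (hC : ∀ (c : ℤ_[p]) (x : X) (s : S) (k : ℕ), p ^ k • s = 0 →
      toDual ((PowerSeries.C (PowerSeries.C c : PowerSeries ℤ_[p]) : PowerSeries (PowerSeries ℤ_[p])) • x) s =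
        (PadicInt.toZModPow k c).val • toDual x s)
    (hnil : IwasawaDual.IsLocNil₂ p ψ₁ ψ₂)
    (hfin : Set.Finite {s : S | p • s = 0 ∧ ψ₁ s = 0 ∧ ψ₂ s = 0}) :
    Module.Finite (PowerSeries (PowerSeries ℤ_[p])) X := by
  classical
  have hp := (Fact.out : p.Prime)
  -- notation for the two variables
  set T₁ : PowerSeries (PowerSeries ℤ_[p]) := PowerSeries.X with hT₁def
  set T₂ : PowerSeries (PowerSeries ℤ_[p]) := PowerSeries.C PowerSeries.X with hT₂def
  /- ### Step 0: iterated action identities and commutation -/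
  have hT₁pow : ∀ (j : ℕ) (x : X) (s : S), toDual (T₁ ^ j • x) s = toDual x ((ψ₁ ^ j) s) := by
    intro j
    induction j with
    | zero => intro x s; simp
    | succ j ih =>
      intro x s
      rw [pow_succ', mul_smul, hT₁, ih, pow_succ, AddMonoid.End.coe_mul, Function.comp_apply]
  have hT₂pow : ∀ (j : ℕ) (x : X) (s : S), toDual (T₂ ^ j • x) s = toDual x ((ψ₂ ^ j) s) := by
    intro j
    induction j with
    | zero => intro x s; simp
    | succ j ih =>
      intro x s
      rw [pow_succ', mul_smul, hT₂, ih, pow_succ, AddMonoid.End.coe_mul, Function.comp_apply]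
  have hcomm₁ : ∀ (l : ℕ) (s : S), ψ₁ ((ψ₂ ^ l) s) = (ψ₂ ^ l) (ψ₁ s) := fun l s ↦ by
    have := (hnil.comm.pow_right l).eq
    change (ψ₁ * ψ₂ ^ l) s = (ψ₂ ^ l * ψ₁) s
    rw [this]
  have hcomm₂ : ∀ (j : ℕ) (s : S), ψ₂ ((ψ₁ ^ j) s) = (ψ₁ ^ j) (ψ₂ s) := fun j s ↦ by
    have := (hnil.comm.symm.pow_right j).eq
    change (ψ₂ * ψ₁ ^ j) s = (ψ₁ ^ j * ψ₂) s
    rw [this]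
  /- ### Step 1: the annihilators `X⁽ⁿ⁾` and the filtration `M_k` -/
  let ann : ℕ → AddSubgroup X := fun n ↦
    { carrier := {x | ∀ s : S, p ^ n • s = 0 → (ψ₁ ^ n) s = 0 → (ψ₂ ^ n) s = 0 → toDual x s = 0}
      zero_mem' := fun s _ _ _ ↦ by rw [map_zero, AddMonoidHom.zero_apply]
      add_mem' := fun {a b} ha hb s h1 h2 h3 ↦ by
        rw [map_add, AddMonoidHom.add_apply, ha s h1 h2 h3, hb s h1 h2 h3, add_zero]
      neg_mem' := fun {a} ha s h1 h2 h3 ↦ by rw [map_neg, AddMonoidHom.neg_apply, ha s h1 h2 h3, neg_zero] }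
  have mem_ann : ∀ {n : ℕ} {x : X}, x ∈ ann n ↔
      ∀ s : S, p ^ n • s = 0 → (ψ₁ ^ n) s = 0 → (ψ₂ ^ n) s = 0 → toDual x s = 0 := Iff.rfl
  have ann_anti : ∀ {m n : ℕ}, m ≤ n → ann n ≤ ann m := by
    intro m n hmn x hx
    rw [mem_ann] at hx ⊢
    intro s h1 h2 h3
    obtain ⟨c, hc⟩ := Nat.exists_eq_add_of_le hmn
    refine hx s ?_ ?_ ?_
    · rw [hc, Nat.add_comm, pow_add, mul_smul, h1, smul_zero]
    · rw [hc, Nat.add_comm, pow_add, AddMonoid.End.coe_mul, Function.comp_apply, h2, map_zero]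
    · rw [hc, Nat.add_comm, pow_add, AddMonoid.End.coe_mul, Function.comp_apply, h3, map_zero]
  -- `⋂ X⁽ⁿ⁾ = 0`
  have ann_sep : ∀ x : X, (∀ n, x ∈ ann n) → x = 0 := by
    intro x hx
    apply hbij.1
    rw [map_zero]
    ext s
    obtain ⟨k, hk⟩ := hnil.torsion s
    obtain ⟨N₁, hN₁⟩ := hnil.nil₁ s
    obtain ⟨N₂, hN₂⟩ := hnil.nil₂ s
    rw [AddMonoidHom.zero_apply]
    refine (mem_ann.mp (hx (k + N₁ + N₂))) s ?_ ?_ ?_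
    · rw [show k + N₁ + N₂ = (N₁ + N₂) + k by omega, pow_add, mul_smul, hk, smul_zero]
    · rw [show k + N₁ + N₂ = (k + N₂) + N₁ by omega, pow_add, AddMonoid.End.coe_mul,
        Function.comp_apply, hN₁, map_zero]
    · rw [show k + N₁ + N₂ = (k + N₁) + N₂ by omega, pow_add, AddMonoid.End.coe_mul,
        Function.comp_apply, hN₂, map_zero]
  -- the filtration `M_k`: `M_0 = ⊤`, `M_{k+1} = p M_k + T₁ M_k + T₂ M_k`
  let step : AddSubgroup X → AddSubgroup X := fun A ↦
    (A.map (DistribSMul.toAddMonoidHom X (p : ℕ)) ⊔ A.map (DistribSMul.toAddMonoidHom X T₁)) ⊔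
      A.map (DistribSMul.toAddMonoidHom X T₂)
  let M : ℕ → AddSubgroup X := fun k ↦ step^[k] ⊤
  have hM0 : M 0 = ⊤ := rfl
  have hMsucc : ∀ k, M (k + 1) = step (M k) := fun k ↦ Function.iterate_succ_apply' step k ⊤
  have p_mem : ∀ {k : ℕ} {x : X}, x ∈ M k → p • x ∈ M (k + 1) := fun {k x} hx ↦ by
    rw [hMsucc]
    exact AddSubgroup.mem_sup_left (AddSubgroup.mem_sup_left (AddSubgroup.mem_map_of_mem _ hx))
  have T₁_mem : ∀ {k : ℕ} {x : X}, x ∈ M k → T₁ • x ∈ M (k + 1) := fun {k x} hx ↦ by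
    rw [hMsucc]
    exact AddSubgroup.mem_sup_left (AddSubgroup.mem_sup_right (AddSubgroup.mem_map_of_mem _ hx))
  have T₂_mem : ∀ {k : ℕ} {x : X}, x ∈ M k → T₂ • x ∈ M (k + 1) := fun {k x} hx ↦ by
    rw [hMsucc]
    exact AddSubgroup.mem_sup_right (AddSubgroup.mem_map_of_mem _ hx)
  -- `M_k` kills every `s` with `pⁱ s = 0`, `ψ₁ʲ s = 0`, `ψ₂ˡ s = 0`, `i + j + l ≤ k`
  have hMkill : ∀ (k : ℕ) (x : X), x ∈ M k → ∀ (i j l : ℕ), i + j + l ≤ k → ∀ s : S,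
      p ^ i • s = 0 → (ψ₁ ^ j) s = 0 → (ψ₂ ^ l) s = 0 → toDual x s = 0 := by
    intro k
    induction k with
    | zero =>
      intro x _ i j l hijl s hsi _ _
      obtain ⟨rfl, -, -⟩ : i = 0 ∧ j = 0 ∧ l = 0 := by omega
      rw [pow_zero, one_smul] at hsi
      rw [hsi, map_zero]
    | succ k ih =>
      intro x hx i j l hijl s hsi hsj hsl
      rw [hMsucc] at hx
      change x ∈ ((M k).map _ ⊔ (M k).map _) ⊔ (M k).map _ at hx
      obtain ⟨yz, hyz, w, hw, rfl⟩ := AddSubgroup.mem_sup.mp hx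
      obtain ⟨y, hy, z, hz, rfl⟩ := AddSubgroup.mem_sup.mp hyz
      obtain ⟨y', hy', rfl⟩ := AddSubgroup.mem_map.mp hy
      obtain ⟨z', hz', rfl⟩ := AddSubgroup.mem_map.mp hz
      obtain ⟨w', hw', rfl⟩ := AddSubgroup.mem_map.mp hw
      simp only [DistribSMul.toAddMonoidHom_apply, map_add, AddMonoidHom.add_apply]
      have hy0 : toDual (p • y') s = 0 := by
        rw [IwasawaDual.nsmul_eval]
        rcases Nat.eq_zero_or_pos i with rfl | hi
        · rw [pow_zero, one_smul] at hsi
          rw [hsi, smul_zero, map_zero]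
        · refine ih y' hy' (i - 1) j l (by omega) _ ?_ ?_ ?_
          · rw [smul_smul, ← pow_succ, Nat.sub_add_cancel hi, hsi]
          · rw [map_nsmul, hsj, smul_zero]
          · rw [map_nsmul, hsl, smul_zero]
      have hz0 : toDual (T₁ • z') s = 0 := by
        rw [hT₁]
        rcases Nat.eq_zero_or_pos j with rfl | hj
        · rw [pow_zero, AddMonoid.End.one_apply] at hsj
          rw [hsj, map_zero, map_zero]
        · refine ih z' hz' i (j - 1) l (by omega) _ ?_ ?_ ?_
          · rw [← map_nsmul, hsi, map_zero]
          · rw [← Function.comp_apply (f := ψ₁ ^ (j - 1)), ← AddMonoid.End.coe_mul, ← pow_succ,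
              Nat.sub_add_cancel hj, hsj]
          · rw [← hcomm₁, hsl, map_zero]
      have hw0 : toDual (T₂ • w') s = 0 := by
        rw [hT₂]
        rcases Nat.eq_zero_or_pos l with rfl | hl
        · rw [pow_zero, AddMonoid.End.one_apply] at hsl
          rw [hsl, map_zero, map_zero]
        · refine ih w' hw' i j (l - 1) (by omega) _ ?_ ?_ ?_
          · rw [← map_nsmul, hsi, map_zero]
          · rw [← hcomm₂, hsj, map_zero]
          · rw [← Function.comp_apply (f := ψ₂ ^ (l - 1)), ← AddMonoid.End.coe_mul, ← pow_succ,
              Nat.sub_add_cancel hl, hsl]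
      rw [hy0, hz0, hw0, add_zero, add_zero]
  -- `M_{3n} ⊆ X⁽ⁿ⁾`
  have hM3 : ∀ n : ℕ, M (3 * n) ≤ ann n := fun n x hx ↦
    mem_ann.mpr fun s h1 h2 h3 ↦ hMkill (3 * n) x hx n n n (by omega) s h1 h2 h3
  -- bootstrapping `N + M_1 = X ⟹ N + M_k = X`
  have hboot : ∀ N : Submodule (PowerSeries (PowerSeries ℤ_[p])) X,
      N.toAddSubgroup ⊔ M 1 = ⊤ → ∀ k, N.toAddSubgroup ⊔ M k = ⊤ := by
    intro N h1 k
    induction k with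
    | zero => exact eq_top_iff.mpr fun x _ ↦ AddSubgroup.mem_sup_right (by rw [hM0]; trivial)
    | succ k ih =>
      rw [eq_top_iff]
      intro x _
      have hx : x ∈ N.toAddSubgroup ⊔ M 1 := h1 ▸ AddSubgroup.mem_top x
      obtain ⟨ν, hν, m, hm, rfl⟩ := AddSubgroup.mem_sup.mp hx
      refine AddSubgroup.add_mem _ (AddSubgroup.mem_sup_left hν) ?_
      rw [show (1 : ℕ) = 0 + 1 from rfl, hMsucc] at hm
      change m ∈ ((M 0).map _ ⊔ (M 0).map _) ⊔ (M 0).map _ at hm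
      obtain ⟨yz, hyz, w, hw, rfl⟩ := AddSubgroup.mem_sup.mp hm
      obtain ⟨y, hy, z, hz, rfl⟩ := AddSubgroup.mem_sup.mp hyz
      obtain ⟨y', -, rfl⟩ := AddSubgroup.mem_map.mp hy
      obtain ⟨z', -, rfl⟩ := AddSubgroup.mem_map.mp hz
      obtain ⟨w', -, rfl⟩ := AddSubgroup.mem_map.mp hw
      simp only [DistribSMul.toAddMonoidHom_apply]
      have hy' : y' ∈ N.toAddSubgroup ⊔ M k := ih ▸ AddSubgroup.mem_top y'
      have hz' : z' ∈ N.toAddSubgroup ⊔ M k := ih ▸ AddSubgroup.mem_top z'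
      have hw' : w' ∈ N.toAddSubgroup ⊔ M k := ih ▸ AddSubgroup.mem_top w'
      obtain ⟨y₁, hy₁, y₂, hy₂, rfl⟩ := AddSubgroup.mem_sup.mp hy'
      obtain ⟨z₁, hz₁, z₂, hz₂, rfl⟩ := AddSubgroup.mem_sup.mp hz'
      obtain ⟨w₁, hw₁, w₂, hw₂, rfl⟩ := AddSubgroup.mem_sup.mp hw'
      rw [smul_add, smul_add, smul_add]
      refine AddSubgroup.add_mem _ (AddSubgroup.add_mem _
        (AddSubgroup.add_mem _ (AddSubgroup.mem_sup_left ?_) (AddSubgroup.mem_sup_right (p_mem hy₂)))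
        (AddSubgroup.add_mem _ (AddSubgroup.mem_sup_left ?_) (AddSubgroup.mem_sup_right (T₁_mem hz₂))))
        (AddSubgroup.add_mem _ (AddSubgroup.mem_sup_left ?_) (AddSubgroup.mem_sup_right (T₂_mem hw₂)))
      · exact N.smul_of_tower_mem p hy₁
      · exact N.smul_mem _ hz₁
      · exact N.smul_mem _ hw₁
  -- duality: `X⁽¹⁾ ⊆ M_1`
  have hdual : ann 1 ≤ M 1 := by
    intro x hx
    have hx' : ∀ s : S, p • s = 0 → ψ₁ s = 0 → ψ₂ s = 0 → toDual x s = 0 := fun s h1 h2 h3 ↦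
      mem_ann.mp hx s (by rw [pow_one]; exact h1) (by rw [pow_one]; exact h2) (by rw [pow_one]; exact h3)
    obtain ⟨x₁, x₂, x₃, rfl⟩ := exists_eq_nsmul_add_smul_add_smul_of_forall hbij hT₁ hT₂ hx'
    have h0 : ∀ y : X, y ∈ M 0 := fun y ↦ by rw [hM0]; trivial
    exact AddSubgroup.add_mem _ (AddSubgroup.add_mem _ (p_mem (h0 x₁)) (T₁_mem (h0 x₂)))
      (T₂_mem (h0 x₃))
  -- congruent coefficients act alike modulo `X⁽ⁿ⁾`
  have hsmul_ann : ∀ (n : ℕ) (f : PowerSeries (PowerSeries ℤ_[p])),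
      (∀ j < n, ∀ l < n, (p : ℤ_[p]) ^ n ∣ PowerSeries.coeff l (PowerSeries.coeff j f)) →
      ∀ g : X, f • g ∈ ann n := by
    intro n f hf g
    obtain ⟨Q, V, W, rfl⟩ := exists_eq_C_mul_add_X_pow_mul_add hf
    rw [mem_ann]
    intro s h1 h2 h3
    rw [add_smul, add_smul, map_add, map_add, AddMonoidHom.add_apply, AddMonoidHom.add_apply, mul_smul,
      mul_smul, mul_smul, hC _ _ s n h1, hT₁pow, hT₂pow, h2, h3, map_zero, map_zero, add_zero, add_zero]
    have : PadicInt.toZModPow n ((p : ℤ_[p]) ^ n) = 0 := by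
      rw [map_pow, map_natCast, ← Nat.cast_pow, ZMod.natCast_self]
    rw [this, ZMod.val_zero, zero_smul]
  /- ### Step 2: generators — finitely many restrictions to `S_1` -/
  let S₁ : Set S := {s : S | p • s = 0 ∧ ψ₁ s = 0 ∧ ψ₂ s = 0}
  haveI : Finite S₁ := hfin.to_subtype
  haveI : Finite {u : AddCircle (1 : ℚ) // p • u = 0} :=
    (AddCircle.finite_torsion (1 : ℚ) hp.pos).to_subtype
  let ρ : X → (S₁ → {u : AddCircle (1 : ℚ) // p • u = 0}) := fun x s ↦
    ⟨toDual x s, by rw [← map_nsmul, s.2.1, map_zero]⟩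
  let R := Set.range ρ
  haveI : Finite R := inferInstance
  letI : Fintype R := Fintype.ofFinite R
  choose rep hrep using fun r : R ↦ r.2
  let N : Submodule (PowerSeries (PowerSeries ℤ_[p])) X := Submodule.span _ (Set.range rep)
  -- `N + M_1 = X`
  have h1 : N.toAddSubgroup ⊔ M 1 = ⊤ := by
    rw [eq_top_iff]
    intro x _
    have hx : x - rep ⟨ρ x, x, rfl⟩ ∈ ann 1 := by
      rw [mem_ann]
      intro s hs1 hs2 hs3
      rw [pow_one] at hs1 hs2 hs3
      have e := congrArg (fun f ↦ ((f ⟨s, ⟨hs1, hs2, hs3⟩⟩ : {u : AddCircle (1 : ℚ) // p • u = 0}) :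
        AddCircle (1 : ℚ))) (hrep ⟨ρ x, x, rfl⟩)
      simp only [ρ] at e
      rw [map_sub, AddMonoidHom.sub_apply, sub_eq_zero]
      exact e.symm
    have := AddSubgroup.add_mem _ (AddSubgroup.mem_sup_left (Submodule.subset_span ⟨_, rfl⟩ :
      rep ⟨ρ x, x, rfl⟩ ∈ N.toAddSubgroup)) (AddSubgroup.mem_sup_right (hdual hx) :
        x - rep ⟨ρ x, x, rfl⟩ ∈ N.toAddSubgroup ⊔ M 1)
    rwa [add_sub_cancel] at this
  -- `N + X⁽ⁿ⁾ = X`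
  have h2 : ∀ (n : ℕ) (x : X), ∃ a : R → PowerSeries (PowerSeries ℤ_[p]),
      x - ∑ r, a r • rep r ∈ ann n := by
    intro n x
    have hx : x ∈ N.toAddSubgroup ⊔ M (3 * n) := (hboot N h1 (3 * n)) ▸ AddSubgroup.mem_top x
    obtain ⟨ν, hν, m, hm, rfl⟩ := AddSubgroup.mem_sup.mp hx
    obtain ⟨a, ha⟩ := (Submodule.mem_span_range_iff_exists_fun _).mp hν
    refine ⟨a, ?_⟩
    rw [ha, add_sub_cancel_left]
    exact hM3 n hm
  /- ### Step 3: compactness of `Λ₂^d` and Cantor's intersection theorem -/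
  haveI : CompactSpace (PowerSeries ℤ_[p]) := inferInstanceAs (CompactSpace ((Unit →₀ ℕ) → ℤ_[p]))
  haveI : CompactSpace (PowerSeries (PowerSeries ℤ_[p])) :=
    inferInstanceAs (CompactSpace ((Unit →₀ ℕ) → PowerSeries ℤ_[p]))
  have hgen : ∀ x : X, x ∈ N := by
    intro x
    let A : ℕ → Set (R → PowerSeries (PowerSeries ℤ_[p])) := fun n ↦
      {a | x - ∑ r, a r • rep r ∈ ann n}
    -- congruent vectors lie in the same `A n`
    have hstab : ∀ n a a', a ∈ A n → (∀ i, ∀ j < n, ∀ l < n,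
        (p : ℤ_[p]) ^ n ∣ PowerSeries.coeff l (PowerSeries.coeff j (a i)) -
          PowerSeries.coeff l (PowerSeries.coeff j (a' i))) → a' ∈ A n := by
      intro n a a' ha hc
      have hdiff : (∑ r, a r • rep r) - ∑ r, a' r • rep r ∈ ann n := by
        rw [← Finset.sum_sub_distrib]
        refine AddSubgroup.sum_mem _ fun r _ ↦ ?_
        rw [← sub_smul]
        exact hsmul_ann n _ (fun j hj l hl ↦ by rw [map_sub, map_sub]; exact hc r j hj l hl) (rep r)
      have := AddSubgroup.add_mem _ ha hdiff
      simp only [A, Set.mem_setOf_eq]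
      convert this using 1
      abel
    have hsymm : ∀ (n : ℕ) (a a' : R → PowerSeries (PowerSeries ℤ_[p])),
        (∀ i, ∀ j < n, ∀ l < n, (p : ℤ_[p]) ^ n ∣ PowerSeries.coeff l (PowerSeries.coeff j (a i)) -
          PowerSeries.coeff l (PowerSeries.coeff j (a' i))) →
        (∀ i, ∀ j < n, ∀ l < n, (p : ℤ_[p]) ^ n ∣ PowerSeries.coeff l (PowerSeries.coeff j (a' i)) -
          PowerSeries.coeff l (PowerSeries.coeff j (a i))) :=
      fun n a a' hc i j hj l hl ↦ by rw [← neg_sub]; exact (hc i j hj l hl).neg_right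
    have hrefl : ∀ (n : ℕ) (a : R → PowerSeries (PowerSeries ℤ_[p])),
        ∀ i, ∀ j < n, ∀ l < n, (p : ℤ_[p]) ^ n ∣ PowerSeries.coeff l (PowerSeries.coeff j (a i)) -
          PowerSeries.coeff l (PowerSeries.coeff j (a i)) := fun n a i j _ l _ ↦ by simp
    have hopen : ∀ n, IsOpen (A n) := by
      intro n
      rw [isOpen_iff_forall_mem_open]
      intro a ha
      exact ⟨_, fun a' ha' ↦ hstab n a a' ha ha', isOpen_setOf_coeff_cong₂ n a, hrefl n a⟩
    have hclosed : ∀ n, IsClosed (A n) := by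
      intro n
      rw [← isOpen_compl_iff, isOpen_iff_forall_mem_open]
      intro a ha
      refine ⟨_, fun a' ha' h' ↦ ha (hstab n a' a h' (hsymm n a a' ha')), isOpen_setOf_coeff_cong₂ n a,
        hrefl n a⟩
    have hanti : ∀ n, A (n + 1) ⊆ A n := fun n a ha ↦ ann_anti (Nat.le_succ n) ha
    have hne : ∀ n, (A n).Nonempty := fun n ↦ h2 n x
    obtain ⟨a, ha⟩ := IsCompact.nonempty_iInter_of_sequence_nonempty_isCompact_isClosed A hanti hne
      (hclosed 0).isCompact hclosed
    have hz : x - ∑ r, a r • rep r = 0 := ann_sep _ fun n ↦ Set.mem_iInter.mp ha n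
    rw [sub_eq_zero] at hz
    rw [hz]
    exact Submodule.sum_mem _ fun r _ ↦ Submodule.smul_mem _ _ (Submodule.subset_span ⟨r, rfl⟩)
  refine ⟨⟨(Finset.univ.image rep), ?_⟩⟩
  rw [Finset.coe_image, Finset.coe_univ, Set.image_univ]
  exact eq_top_iff.mpr fun x _ ↦ hgen x

/-- **The registered stub `stub_nakayamaDualTwoVar` of line `bdpline` (v5) — VERBATIM**: Nakayama for
duals over `Λ₂ = ℤ_p⟦T₂⟧⟦T₁⟧` — if a `Λ₂`-module `X` is identified (`toDual`, bijective) with the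
character group `Hom(S, ℚ/ℤ)` of an abelian group `S` carrying two commuting locally nilpotent
endomorphisms `ψ₁, ψ₂` (`IsLocNil₂`), with `T₁ = X` acting as `ψ₁`, `T₂ = C X` as `ψ₂` and constants
through `ℤ_p → ℤ/p^k`, and the joint kernel `S[p] ∩ ker ψ₁ ∩ ker ψ₂` (= the Pontryagin dual of `X/𝔪X`,
`𝔪 = (p, T₁, T₂)`) is finite, then `X` is finitely generated over `Λ₂` (`module_finite_of_dualPair₂`).
The composition of the line applies it with `S = unrSelmer₂ κ₁ κ₂ E[p^∞] v̄`, `X = XGr₂`, `toDual = id`,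
`ψᵢ = conjSel₂ γᵢ − 1`. [cite: Lang1990, Ch. 5 §1 (Nakayama's lemma)]
[cite: GreenbergLNM1716, §1 p. 60 (after Conj. 1.3)] -/
theorem stub_nakayamaDualTwoVar :
    ∀ (p : ℕ) [Fact p.Prime] (S X : Type) [AddCommGroup S] [AddCommGroup X] [Module (PowerSeries (PowerSeries ℤ_[p])) X] (ψ₁ ψ₂ : AddMonoid.End S) (toDual : X →+ (S →+ AddCircle (1 : ℚ))), Function.Bijective toDual → (∀ (x : X) (s : S), toDual ((PowerSeries.X : PowerSeries (PowerSeries ℤ_[p])) • x) s = toDual x (ψ₁ s)) → (∀ (x : X) (s : S), toDual ((PowerSeries.C (PowerSeries.X : PowerSeries ℤ_[p]) : PowerSeries (PowerSeries ℤ_[p])) • x) s = toDual x (ψ₂ s)) → (∀ (c : ℤ_[p]) (x : X) (s : S) (k : ℕ), p ^ k • s = 0 → toDual ((PowerSeries.C (PowerSeries.C c : PowerSeries ℤ_[p]) : PowerSeries (PowerSeries ℤ_[p])) • x) s = (PadicInt.toZModPow k c).val • toDual x s) → Literature.NumberTheory.EllipticCurves.IwasawaDual.IsLocNil₂ p ψ₁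 ψ₂ → Set.Finite {s : S | p • s = 0 ∧ ψ₁ s = 0 ∧ ψ₂ s = 0} → Module.Finite (PowerSeries (PowerSeries ℤ_[p])) X :=
  fun _ _ _ _ _ _ _ _ _ toDual hbij hT₁ hT₂ hC hnil hfin ↦
    module_finite_of_dualPair₂ toDual hbij hT₁ hT₂ hC hnil hfin

end Summit.BirchSwinnertonDyer.BirchSwinnertonDyer.Theorems.SignedBaseChangeAcDivNakayamaTwoVar

end
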